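import Literature.Probability.RandomPlanarGeometry.SLEDerivRatioMoments
import HarnessLib

/-!
# The SLE_κ slope `w_t = x_t/y_t` is not eventually confined to a bounded interval (`κ < 8`)

Topic `Probability/RandomPlanarGeometry`; theorems only. Second layer of the proof of the named fact
`Literature.Probability.RandomPlanarGeometry.Schramm2001_slope_dichotomy` (`SchrammLeftPassage.lean`;
O. Schramm, *A percolation formula*, Electron. Comm. Probab. **6** (2001), proof of Thm. 2: "the
diffusion process `dw = -dW̃ + 4w du/(w² + 1)` is transient"). Transience of the slope diffusion in
Schramm's clock `u = ∫ dt/y²` has two halves; this file proves the "recurrent sets are left" half in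
the original time `t`:

* **for `0 < κ < 8`, `z ∈ ℍ` and every level `L`, almost surely there is NO time `t₀ < τ(z)` with
  `|w_t| ≤ L` for all `t ∈ [t₀, τ(z))`** (`ae_frequently_lt_abs_cotArg`, stated positively: a.s.,
  cofinally in `[0, τ(z))`, `|w_t| > L`).

Proof. Pathwise (every continuous driving function, `Loewner.tendsto_derivRatio_atTop_of_abs_cotArg_le_of_le`,
the tail version of the tree's `Loewner.tendsto_derivRatio_atTop_of_abs_cotArg_le`): if `|w_t| ≤ L` on
`[t₀, τ(z))` then Rohde–Schramm's ratio `ψ_t = (Im z)|g_t'(z)|/Im g_t(z) = exp ∫₀ᵗ 4y²/|z|⁴` tends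
to `∞` as `t ↑ τ(z)`, because on `[t₀, t]` the rate is `≥ 4/((Im z)²(1+L²)²)` (case `τ = ∞`) and
`∫_{t₀}^t 4y²/|z|⁴ ≥ (2/(1+L²))(log y_{t₀} - log y_t)` with `y_t → 0` (case `τ < ∞`) — this is the
divergence of Schramm's clock `u(t) = ∫₀ᵗ ds/y_s² → ∞` as `t ↑ τ(z₀)` read through (6.3). But for
`κ < 8`, **a.s. `Z(z) = sup_{t<τ} ψ_t < ∞`** (`ae_not_tendsto_derivRatio_atTop`), since
`E[sup_t ψ_t^a] < ∞` for `0 ≤ a < 1 - κ/8` (Rohde–Schramm (2005), Lemma 6.3; the tree's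
`lintegral_iSup_slePointRatioPow_le`, `SLEDerivRatioMoments.lean`).

No named facts are introduced.

## References

* O. Schramm, *A percolation formula*, Electron. Comm. Probab. 6 (2001), proof of Thm. 2.
* S. Rohde, O. Schramm, *Basic properties of SLE*, Ann. of Math. 161 (2005), Lemma 6.3 and its
  proof, eqs. (3.4), (6.3).
-/

noncomputable section

open Set Filter MeasureTheory Complex
open _root_.Topology
open scoped NNReal ENNReal

namespace Literature.Probability.RandomPlanarGeometry

namespace Loewner

variable {W : ℝ≥0 → ℝ} {z : ℂ}

/-! ### Pathwise: divergence of `ψ` when `|w|` stays bounded on a tail `[t₀, τ)` -/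

/-- The rate `4y²/|z|⁴` is interval integrable on every `[t₀, t] ⊆ [0, τ(z))`. [folklore] -/
theorem intervalIntegrable_derivRatioRate_of_le (hW : Continuous W) {t₀ t : ℝ≥0} (h0t : t₀ ≤ t)
    (ht : (t : WithTop ℝ≥0) < swallowingTime W z) :
    IntervalIntegrable (derivRatioRate W z) volume t₀ t :=
  (intervalIntegrable_derivRatioRate hW ht).mono_set (by
    rw [uIcc_of_le (NNReal.coe_le_coe.2 h0t), uIcc_of_le t.coe_nonneg]
    exact Icc_subset_Icc t₀.coe_nonneg le_rfl)

/-- `∫₀ᵗ rate = ∫₀^{t₀} rate + ∫_{t₀}^t rate ≥ ∫_{t₀}^t rate` (the rate is non-negative). [folklore] -/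
theorem integral_derivRatioRate_tail_le (hW : Continuous W) {t₀ t : ℝ≥0} (h0t : t₀ ≤ t)
    (ht : (t : WithTop ℝ≥0) < swallowingTime W z) :
    ∫ u in (t₀ : ℝ)..t, derivRatioRate W z u ≤ ∫ u in (0 : ℝ)..t, derivRatioRate W z u := by
  have ht₀ : (t₀ : WithTop ℝ≥0) < swallowingTime W z := lt_of_le_of_lt (WithTop.coe_le_coe.2 h0t) ht
  have hadd := intervalIntegral.integral_add_adjacent_intervals
    (intervalIntegrable_derivRatioRate hW ht₀) (intervalIntegrable_derivRatioRate_of_le hW h0t ht)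
  have hnn := integral_derivRatioRate_nonneg W z t₀.coe_nonneg
  linarith

/-- **Case `τ = ∞`, tail form**: if `|w_u| ≤ s` for `u ∈ [t₀, t]`, `t < τ(z)`, then
`∫_{t₀}^t 4y²/|z|⁴ ≥ 4 (t - t₀)/((Im z)²(1 + s²)²)`. [cite: RohdeSchramm2005, eq. (6.3)] -/
theorem mul_sub_le_integral_derivRatioRate (hW : Continuous W) (hz : 0 < z.im) {s : ℝ} {t₀ t : ℝ≥0}
    (h0t : t₀ ≤ t) (ht : (t : WithTop ℝ≥0) < swallowingTime W z)
    (hs : ∀ u : ℝ≥0, t₀ ≤ u → u ≤ t → |cotArg W z u| ≤ s) :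
    4 / (z.im ^ 2 * (1 + s ^ 2) ^ 2) * ((t : ℝ) - t₀) ≤ ∫ u in (t₀ : ℝ)..t, derivRatioRate W z u := by
  have hc : ∫ _ in (t₀ : ℝ)..t, (4 / (z.im ^ 2 * (1 + s ^ 2) ^ 2) : ℝ) =
      4 / (z.im ^ 2 * (1 + s ^ 2) ^ 2) * ((t : ℝ) - t₀) := by
    rw [intervalIntegral.integral_const, smul_eq_mul, mul_comm]
  rw [← hc]
  refine intervalIntegral.integral_mono_on (NNReal.coe_le_coe.2 h0t) intervalIntegrable_const
    (intervalIntegrable_derivRatioRate_of_le hW h0t ht) fun u hu ↦ ?_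
  have hu0 : 0 ≤ u := t₀.coe_nonneg.trans hu.1
  have hule : u.toNNReal ≤ t := by
    rw [← NNReal.coe_le_coe, Real.coe_toNNReal _ hu0]; exact hu.2
  have hleu : t₀ ≤ u.toNNReal := by
    rw [← NNReal.coe_le_coe, Real.coe_toNNReal _ hu0]; exact hu.1
  have huτ : ((u.toNNReal : ℝ≥0) : WithTop ℝ≥0) < swallowingTime W z :=
    lt_of_le_of_lt (WithTop.coe_le_coe.2 hule) ht
  have hy : 0 < (centredMap W u.toNNReal z).im := im_centredMap_pos hW hz huτ
  have hyle : (centredMap W u.toNNReal z).im ≤ z.im := im_centredMap_le hW hz huτ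
  rw [derivRatioRate_eq_centredMap]
  refine le_trans ?_ (div_le_rate_of_abs_le hy (hs _ hleu hule))
  have h1 : (0 : ℝ) < (1 + s ^ 2) ^ 2 := by positivity
  have hy2 : 0 < (centredMap W u.toNNReal z).im ^ 2 := by positivity
  gcongr

/-- **(3.4) on a tail**: `∫_{t₀}^t 2/|z_u|² du = log y_{t₀} - log y_t` for `t₀ ≤ t < τ(z)`.
[cite: RohdeSchramm2005, eq. (3.4)] -/
theorem integral_two_div_normSq_eq_log_sub (hW : Continuous W) (hz : 0 < z.im) {t₀ t : ℝ≥0}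
    (h0t : t₀ ≤ t) (ht : (t : WithTop ℝ≥0) < swallowingTime W z) :
    ∫ u in (t₀ : ℝ)..t, 2 / Complex.normSq (centredMap W u.toNNReal z) =
      Real.log (centredMap W t₀ z).im - Real.log (centredMap W t z).im := by
  have ht₀ : (t₀ : WithTop ℝ≥0) < swallowingTime W z := lt_of_le_of_lt (WithTop.coe_le_coe.2 h0t) ht
  have hzW : z ≠ W 0 := ne_driving_of_im_pos hz 0
  have htT := toNNReal_coe_lt ht
  have hsub := Icc_subset_timeDomain (T := swallowingTime W z) htT
  have hcont : ContinuousOn (fun u : ℝ ↦ 2 / Complex.normSq (centredMap W u.toNNReal z)) (Icc 0 t) := by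
    have hc : ContinuousOn (fun u : ℝ ↦ centredMap W u.toNNReal z) (Icc 0 t) := by
      refine (continuousOn_centredMap hW hzW).comp continuous_real_toNNReal.continuousOn ?_
      intro u hu
      exact (hsub hu).2
    refine continuousOn_const.div (Complex.continuous_normSq.comp_continuousOn hc) fun u hu ↦ ?_
    exact (Complex.normSq_pos.2 (centredMap_ne_zero hW hz (hsub hu).2)).ne'
  have hint : ∀ a b : ℝ, a ∈ Icc (0 : ℝ) t → b ∈ Icc (0 : ℝ) t →
      IntervalIntegrable (fun u : ℝ ↦ 2 / Complex.normSq (centredMap W u.toNNReal z)) volume a b := by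
    intro a b ha hb
    refine (hcont.mono ?_).intervalIntegrable
    exact uIcc_subset_Icc ha hb
  have h0mem : (0 : ℝ) ∈ Icc (0 : ℝ) t := ⟨le_rfl, t.coe_nonneg⟩
  have ht₀mem : (t₀ : ℝ) ∈ Icc (0 : ℝ) t := ⟨t₀.coe_nonneg, NNReal.coe_le_coe.2 h0t⟩
  have htmem : (t : ℝ) ∈ Icc (0 : ℝ) t := ⟨t.coe_nonneg, le_rfl⟩
  have hadd := intervalIntegral.integral_add_adjacent_intervals (hint _ _ h0mem ht₀mem)
    (hint _ _ ht₀mem htmem)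
  have h1 := integral_two_div_normSq_eq_log hW hz ht
  have h2 := integral_two_div_normSq_eq_log hW hz ht₀
  linarith

/-- **Case `τ < ∞`, tail form**: if `|w_u| ≤ s` for `u ∈ [t₀, t]`, `t < τ(z)`, then
`∫_{t₀}^t 4y²/|z|⁴ ≥ (2/(1+s²)) (log y_{t₀} - log y_t)`. [cite: RohdeSchramm2005, eq. (6.3)] -/
theorem mul_log_sub_le_integral_derivRatioRate (hW : Continuous W) (hz : 0 < z.im) {s : ℝ}
    {t₀ t : ℝ≥0} (h0t : t₀ ≤ t) (ht : (t : WithTop ℝ≥0) < swallowingTime W z)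
    (hs : ∀ u : ℝ≥0, t₀ ≤ u → u ≤ t → |cotArg W z u| ≤ s) :
    2 / (1 + s ^ 2) * (Real.log (centredMap W t₀ z).im - Real.log (centredMap W t z).im) ≤
      ∫ u in (t₀ : ℝ)..t, derivRatioRate W z u := by
  rw [← integral_two_div_normSq_eq_log_sub hW hz h0t ht, ← intervalIntegral.integral_const_mul]
  have hzW : z ≠ W 0 := ne_driving_of_im_pos hz 0
  have htT := toNNReal_coe_lt ht
  have hsub := Icc_subset_timeDomain (T := swallowingTime W z) htT
  have hcont : ContinuousOn (fun u : ℝ ↦ 2 / Complex.normSq (centredMap W u.toNNReal z)) (Icc 0 t) := by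
    have hc : ContinuousOn (fun u : ℝ ↦ centredMap W u.toNNReal z) (Icc 0 t) := by
      refine (continuousOn_centredMap hW hzW).comp continuous_real_toNNReal.continuousOn ?_
      intro u hu
      exact (hsub hu).2
    refine continuousOn_const.div (Complex.continuous_normSq.comp_continuousOn hc) fun u hu ↦ ?_
    exact (Complex.normSq_pos.2 (centredMap_ne_zero hW hz (hsub hu).2)).ne'
  have hI : Icc (t₀ : ℝ) t ⊆ Icc (0 : ℝ) t := Icc_subset_Icc t₀.coe_nonneg le_rfl
  have hint : IntervalIntegrable (fun u : ℝ ↦ 2 / (1 + s ^ 2) *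
      (2 / Complex.normSq (centredMap W u.toNNReal z))) volume t₀ t :=
    ((continuousOn_const.mul hcont).mono
      (by rw [uIcc_of_le (NNReal.coe_le_coe.2 h0t)]; exact hI)).intervalIntegrable
  refine intervalIntegral.integral_mono_on (NNReal.coe_le_coe.2 h0t) hint
    (intervalIntegrable_derivRatioRate_of_le hW h0t ht) fun u hu ↦ ?_
  have hu0 : 0 ≤ u := t₀.coe_nonneg.trans hu.1
  have huτ : ((u.toNNReal : ℝ≥0) : WithTop ℝ≥0) < swallowingTime W z := (hsub (hI hu)).2
  have hule : u.toNNReal ≤ t := by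
    rw [← NNReal.coe_le_coe, Real.coe_toNNReal _ hu0]; exact hu.2
  have hleu : t₀ ≤ u.toNNReal := by
    rw [← NNReal.coe_le_coe, Real.coe_toNNReal _ hu0]; exact hu.1
  have hy : 0 < (centredMap W u.toNNReal z).im := im_centredMap_pos hW hz huτ
  rw [derivRatioRate_eq_centredMap, mul_comm]
  exact mul_le_rate_of_abs_le hy (hs _ hleu hule)

/-- **If `|w_t| ≤ s` for all `t ∈ [t₀, τ(z))` (some `t₀ < τ(z)`), then `ψ_t → ∞` as `t ↑ τ(z)`**
— the tail version of `tendsto_derivRatio_atTop_of_abs_cotArg_le` (same proof on `[t₀, t]`: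
linear growth of `∫ 4y²/|z|⁴` if `τ = ∞`, logarithmic growth with `y_t → 0` if `τ < ∞`). In
Schramm's words: the clock `u = ∫ dt/y²` of the slope diffusion runs to `+∞` as `t ↑ τ(z₀)`, so a
slope confined to `[-s, s]` would accumulate infinite `∫ 4 du/(1+w²)² = log ψ`.
[cite: RohdeSchramm2005, Lemma 6.3 (proof, eq. (6.3))] -/
theorem tendsto_derivRatio_atTop_of_abs_cotArg_le_of_le (hW : Continuous W) (hz : 0 < z.im) {s : ℝ}
    {t₀ : ℝ≥0} (ht₀ : (t₀ : WithTop ℝ≥0) < swallowingTime W z)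
    (hs : ∀ t : ℝ≥0, t₀ ≤ t → (t : WithTop ℝ≥0) < swallowingTime W z → |cotArg W z t| ≤ s) :
    Tendsto (fun t : {t : ℝ≥0 // (t : WithTop ℝ≥0) < swallowingTime W z} ↦ derivRatio W z t)
      atTop atTop := by
  haveI : Nonempty {t : ℝ≥0 // (t : WithTop ℝ≥0) < swallowingTime W z} := ⟨⟨t₀, ht₀⟩⟩
  have heq : (fun t : {t : ℝ≥0 // (t : WithTop ℝ≥0) < swallowingTime W z} ↦ derivRatio W z t) =
      fun t : {t : ℝ≥0 // (t : WithTop ℝ≥0) < swallowingTime W z} ↦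
        Real.exp (∫ u in (0:ℝ)..((t : ℝ≥0) : ℝ), derivRatioRate W z u) :=
    funext fun t ↦ derivRatio_eq_exp hW hz t.2
  rw [heq, Real.tendsto_exp_comp_atTop]
  rw [tendsto_atTop_atTop]
  intro K
  rcases eq_or_ne (swallowingTime W z) ⊤ with hτ | hτ
  · -- `τ = ∞`: linear growth of the integral on `[t₀, t]`
    set c : ℝ := 4 / (z.im ^ 2 * (1 + s ^ 2) ^ 2) with hc
    have hcpos : 0 < c := by rw [hc]; positivity
    refine ⟨⟨t₀ + (K / c).toNNReal, by rw [hτ]; exact WithTop.coe_lt_top _⟩, fun t ht ↦ ?_⟩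
    have ht' : t₀ + (K / c).toNNReal ≤ (t : ℝ≥0) := Subtype.coe_le_coe.2 ht
    have h0t : t₀ ≤ (t : ℝ≥0) := le_trans (le_add_of_nonneg_right zero_le) ht'
    have hK : K / c ≤ ((t : ℝ≥0) : ℝ) - t₀ := by
      have h1 : ((t₀ + (K / c).toNNReal : ℝ≥0) : ℝ) ≤ ((t : ℝ≥0) : ℝ) := NNReal.coe_le_coe.2 ht'
      rw [NNReal.coe_add] at h1
      linarith [Real.le_coe_toNNReal (K / c)]
    calc K = c * (K / c) := by field_simp
      _ ≤ c * (((t : ℝ≥0) : ℝ) - t₀) := by gcongr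
      _ ≤ ∫ u in (t₀:ℝ)..(t : ℝ≥0), derivRatioRate W z u :=
        mul_sub_le_integral_derivRatioRate hW hz h0t t.2 fun u hu hut ↦
          hs u hu (lt_of_le_of_lt (WithTop.coe_le_coe.2 hut) t.2)
      _ ≤ ∫ u in (0:ℝ)..(t : ℝ≥0), derivRatioRate W z u :=
        integral_derivRatioRate_tail_le hW h0t t.2
  · -- `τ = b < ∞`: `Im z_t → 0` and the logarithmic bound on `[t₀, t]`
    obtain ⟨b, hb⟩ := WithTop.ne_top_iff_exists.1 hτ
    have hy₀ : 0 < (centredMap W t₀ z).im := im_centredMap_pos hW hz ht₀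
    set ε : ℝ := (centredMap W t₀ z).im * Real.exp (-(K * (1 + s ^ 2) / 2)) with hεdef
    have hε : 0 < ε := by rw [hεdef]; positivity
    obtain ⟨t₁, ht₁, hlt⟩ := exists_forall_im_centredMap_lt hW hz hb.symm hε
    have hmax : ((max t₀ t₁ : ℝ≥0) : WithTop ℝ≥0) < swallowingTime W z := by
      rcases le_total t₀ t₁ with h | h
      · rw [max_eq_right h]; exact ht₁
      · rw [max_eq_left h]; exact ht₀
    refine ⟨⟨max t₀ t₁, hmax⟩, fun t ht ↦ ?_⟩
    have ht' : max t₀ t₁ ≤ (t : ℝ≥0) := Subtype.coe_le_coe.2 ht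
    have h0t : t₀ ≤ (t : ℝ≥0) := (le_max_left _ _).trans ht'
    have h1t : t₁ ≤ (t : ℝ≥0) := (le_max_right _ _).trans ht'
    have hyt : 0 < (centredMap W (t : ℝ≥0) z).im := im_centredMap_pos hW hz t.2
    have hy : (centredMap W (t : ℝ≥0) z).im < ε := hlt t h1t t.2
    have h1 : 0 < 1 + s ^ 2 := by positivity
    have hlog : K * (1 + s ^ 2) / 2 ≤
        Real.log (centredMap W t₀ z).im - Real.log (centredMap W (t : ℝ≥0) z).im := by
      have h2 : Real.log (centredMap W (t : ℝ≥0) z).im < Real.log ε := Real.log_lt_log hyt hy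
      have h3 : Real.log ε = Real.log (centredMap W t₀ z).im - K * (1 + s ^ 2) / 2 := by
        rw [hεdef, Real.log_mul hy₀.ne' (Real.exp_pos _).ne', Real.log_exp]; ring
      linarith
    calc K = 2 / (1 + s ^ 2) * (K * (1 + s ^ 2) / 2) := by field_simp
      _ ≤ 2 / (1 + s ^ 2) *
          (Real.log (centredMap W t₀ z).im - Real.log (centredMap W (t : ℝ≥0) z).im) := by gcongr
      _ ≤ ∫ u in (t₀:ℝ)..(t : ℝ≥0), derivRatioRate W z u :=
        mul_log_sub_le_integral_derivRatioRate hW hz h0t t.2 fun u hu hut ↦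
          hs u hu (lt_of_le_of_lt (WithTop.coe_le_coe.2 hut) t.2)
      _ ≤ ∫ u in (0:ℝ)..(t : ℝ≥0), derivRatioRate W z u :=
        integral_derivRatioRate_tail_le hW h0t t.2

end Loewner

/-! ### Almost surely `Z(z) < ∞` (`κ < 8`), hence no eventual confinement of the slope -/

open Loewner Literature.Probability.Process

variable {κ : ℝ≥0} {z : ℂ}

/-- **`E[sup ψ^a] < ∞` gives `sup ψ^a < ∞` a.s.** (`a = (1 - κ/8)/2`; the measurable majorant
`⨆ₙ Ψₙ` of `SLEDerivRatioMoments.lean`). [cite: RohdeSchramm2005, Lemma 6.3] -/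
theorem ae_iSup_slePointRatioPowSeq_lt_top (hκ : 0 < κ) (hκ8 : κ < 8) (hz : 0 < z.im) :
    ∀ᵐ ω ∂preWienerMeasure,
      (⨆ n, slePointRatioPowSeq κ z ((1 - (κ : ℝ) / 8) / 2) n ω) < ⊤ := by
  have hκ8' : (κ : ℝ) < 8 := by exact_mod_cast hκ8
  have ha : (0 : ℝ) ≤ (1 - (κ : ℝ) / 8) / 2 := by linarith
  have ha8 : (1 - (κ : ℝ) / 8) / 2 < 1 - (κ : ℝ) / 8 := by linarith
  obtain ⟨C, hC⟩ := lintegral_iSup_slePointRatioPow_le hκ ha ha8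
  exact ae_lt_top (measurable_iSup_slePointRatioPowSeq κ hz _)
    (ne_top_of_le_ne_top ENNReal.coe_ne_top (hC hz))

/-- **Rohde–Schramm's Lemma 6.3, `κ < 8`: almost surely `Z(z) = lim_{t↑τ} ψ_t < ∞`**, in the form
"`ψ_t` does not tend to `+∞` as `t ↑ τ(z)`" (`ψ_t^a ≤ ⨆ₙ Ψₙ < ∞` for all `t < τ(z)`).
[cite: RohdeSchramm2005, Lemma 6.3] -/
theorem ae_not_tendsto_derivRatio_atTop (hκ : 0 < κ) (hκ8 : κ < 8) (hz : 0 < z.im) :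
    ∀ᵐ ω ∂preWienerMeasure,
      ¬ Tendsto (fun t : {t : ℝ≥0 // (t : WithTop ℝ≥0) < swallowingTime (sleDriving κ ω) z} ↦
        derivRatio (sleDriving κ ω) z t) atTop atTop := by
  have hκ8' : (κ : ℝ) < 8 := by exact_mod_cast hκ8
  set a : ℝ := (1 - (κ : ℝ) / 8) / 2 with ha_def
  have ha : 0 < a := by rw [ha_def]; linarith
  filter_upwards [ae_iSup_slePointRatioPowSeq_lt_top hκ hκ8 hz] with ω hω hT
  have hW := continuous_sleDriving κ ω
  haveI : Nonempty {t : ℝ≥0 // (t : WithTop ℝ≥0) < swallowingTime (sleDriving κ ω) z} :=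
    ⟨⟨0, swallowingTime_pos_holds hW (ne_driving_of_im_pos hz 0)⟩⟩
  set M : ℝ := (⨆ n, slePointRatioPowSeq κ z a n ω).toReal with hM
  have hbound : ∀ t : {t : ℝ≥0 // (t : WithTop ℝ≥0) < swallowingTime (sleDriving κ ω) z},
      derivRatio (sleDriving κ ω) z t ^ a ≤ M := by
    intro t
    have h1 := ofReal_derivRatio_rpow_le_iSup (κ := κ) hz ha.le ω t.2
    have h2 : 0 ≤ derivRatio (sleDriving κ ω) z t ^ a :=
      Real.rpow_nonneg (zero_le_one.trans (one_le_derivRatio hW hz t.2)) a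
    rw [hM]
    exact (ENNReal.ofReal_le_iff_le_toReal hω.ne).1 h1
  have hT' : Tendsto (fun t : {t : ℝ≥0 // (t : WithTop ℝ≥0) < swallowingTime (sleDriving κ ω) z} ↦
      derivRatio (sleDriving κ ω) z t ^ a) atTop atTop := (tendsto_rpow_atTop ha).comp hT
  obtain ⟨t, ht⟩ := (hT'.eventually_gt_atTop M).exists
  exact absurd (hbound t) (not_le.2 ht)

/-- **No eventual confinement of the slope (`0 < κ < 8`, `z ∈ ℍ`)**: for every level `L`, almost
surely, for every `t₀ < τ(z)` there is `t ∈ [t₀, τ(z))` with `|w_t| > L` — the slope diffusion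
leaves every bounded interval at arbitrarily late times (else `ψ → ∞`, contradicting `Z < ∞`).
This is the "recurrent sets are left" half of Schramm's "the diffusion process (5) is transient".
[cite: Schramm2001Percolation, Thm. 2 (proof)] -/
theorem ae_frequently_lt_abs_cotArg (hκ : 0 < κ) (hκ8 : κ < 8) (hz : 0 < z.im) (L : ℝ) :
    ∀ᵐ ω ∂preWienerMeasure, ∀ t₀ : ℝ≥0,
      (t₀ : WithTop ℝ≥0) < swallowingTime (sleDriving κ ω) z →
        ∃ t : ℝ≥0, t₀ ≤ t ∧ (t : WithTop ℝ≥0) < swallowingTime (sleDriving κ ω) z ∧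
          L < |cotArg (sleDriving κ ω) z t| := by
  filter_upwards [ae_not_tendsto_derivRatio_atTop hκ hκ8 hz] with ω hω t₀ ht₀
  by_contra h
  push Not at h
  exact hω (tendsto_derivRatio_atTop_of_abs_cotArg_le_of_le (continuous_sleDriving κ ω) hz ht₀
    fun t h1 h2 ↦ h t h1 h2)

end Literature.Probability.RandomPlanarGeometry
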